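import Summits.AtomisticToContinuum.Crystallization.Theorems.ChartedPlanarOrderLayerChainLiouvilleTailL1
import Summits.AtomisticToContinuum.Crystallization.Theorems.ChartedPlanarOrderProfileSlavingLJ

/-!
# ChartedPlanarOrder · PS_LJ column — E1 `SlavingKernelL1` PROVED, and `PS_LJ ⟸ D1 ∧ W` (decomp-a2c; lens-3 g22's corollary file,
# landed by prover hand 2, gen 9; critic row 419 (1) «PS_LJ(Λ, η) ⟸ E1 SlavingKernelL1 ∧ D1 NashBalance Λ ∧ W TubeMonotone Λ η»)

`…ChartedPlanarOrderLayerChainLiouvilleTailL1.slavingL1_translation` (lens-3 g22 `LayerChainTail.lean` v3 §SlavingL1, p820901) is,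
binder for binder, the hypothesis list of E1 `SlavingKernelL1` of `…ChartedPlanarOrderProfileSlavingLJ` (p819838).  Hence:

* `slavingKernelL1_holds : SlavingKernelL1` — E1 is a tree theorem;
* `profileSlavingLJ_of_pieces : NashBalance Λ → TubeMonotone Λ η → ProfileSlavingLJ Λ η` — the PS column needs D1 and W only.
`[folklore]` (pure chaining); def-free; sorry-free.
-/

noncomputable section

namespace Summit.AtomisticToContinuum.Crystallization.Theorems.ChartedPlanarOrderProfileSlavingLJKernel

open Summit.AtomisticToContinuum.Crystallization.Theorems.ChartedPlanarOrderProfileSlavingLJ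
  (SlavingKernelL1 NashBalance TubeMonotone ProfileSlavingLJ profileSlavingLJ_of)
open Summit.AtomisticToContinuum.Crystallization.Theorems.ChartedPlanarOrderLayerChainLiouvilleTail (slavingL1_translation)

/-- **E1 `SlavingKernelL1` holds** (= `slavingL1_translation`, binder for binder). [folklore] -/
theorem slavingKernelL1_holds : SlavingKernelL1 :=
  fun Φ W _lam κ hκ hκs hκ1 hdom hmono hlip1 w w' hg hg' σ σ' hσ hσ' D hD =>
    slavingL1_translation Φ W κ hκ hκs hκ1 hdom hmono hlip1 w w' hg hg' σ σ' hσ hσ' D hD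

/-- **`PS_LJ(Λ, η) ⟸ D1 NashBalance Λ ∧ W TubeMonotone Λ η`** (E1 discharged). [folklore] -/
theorem profileSlavingLJ_of_pieces {Λ η : ℝ} (hB : NashBalance Λ) (hW : TubeMonotone Λ η) : ProfileSlavingLJ Λ η :=
  profileSlavingLJ_of slavingKernelL1_holds hB hW

end Summit.AtomisticToContinuum.Crystallization.Theorems.ChartedPlanarOrderProfileSlavingLJKernel

end
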